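import Literature.Topology.FourManifolds.PLUniquenessSheets
import HarnessLib

/-!
# Uniqueness of Whitehead-compatible PL structures: coordinates for the two sheets

Continuation of `PLUniquenessSheets`.  The two sheets `K` (in `e₁`-coordinates) and `L` (in
`e₂`-coordinates) of a stage are realised as canonical coordinate complexes `PK`, `PL` in **one**
coordinate space `ℝᴺ` (`CanonicalComplex.canonical`), indexing the vertices of `K` and the
non-shared vertices of `L` by `Fin N` and giving a shared vertex `v` of `L` the index of
`λ v` (`λ = e₁ ∘ F⁻¹ ∘ G ∘ e₂.symm`).  Then every shared simplex of `L` and its image in `K`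
become the *same* coordinate simplex, and the two sheet maps
`fK = F ∘ e₁.symm ∘ realK`, `fL = G ∘ e₂.symm ∘ realL` agree on it (`fK_eq_fL`); every
simplex of either coordinate complex whose image meets `Zc` is such a shared simplex.  This is
the form in which the two bends of a stage (which see only `ℝᴺ`, the sheet map and the chart
`ψ`) will agree near `Zc`.  Also: injectivity, continuity and smooth chart models of the sheet
maps, as required by `BendInput`.

No named facts are introduced (`SheetCoords` is a bookkeeping structure).

## References

* J.R. Munkres, *Elementary differential topology*, Ann. of Math. Studies 54 (1963; rev. 1966),
  §10, 10.1 ("intersect in a subcomplex") and Thm 10.5. [Munkres1966]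
-/

open Set Function Metric
open scoped Topology ContDiff

noncomputable section

namespace Literature.Topology.FourManifolds

open Literature.Analysis.Convexity

local notation "𝔼 " n:arg => EuclideanSpace ℝ (Fin n)

/-! ### Fresh points -/

section Fresh

/-- In `ℝⁿ`, `n ≥ 1`, a finite type embeds avoiding any finite set. [folklore] -/
theorem exists_injective_forall_notMem {n : ℕ} (hn : 0 < n) (S : Finset (𝔼 n)) (α : Type*)
    [Finite α] : ∃ f : α → 𝔼 n, Injective f ∧ ∀ a, f a ∉ S := by
  classical
  have hv : (EuclideanSpace.single (⟨0, hn⟩ : Fin n) (1 : ℝ) : 𝔼 n) ≠ 0 := by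
    intro h
    have := congrArg (fun x : 𝔼 n => x ⟨0, hn⟩) h
    simp at this
  haveI : Infinite (𝔼 n) :=
    Infinite.of_injective (fun r : ℝ => r • (EuclideanSpace.single (⟨0, hn⟩ : Fin n) (1 : ℝ) : 𝔼 n))
      (smul_left_injective ℝ hv)
  have hinf : ((↑S : Set (𝔼 n))ᶜ).Infinite := S.finite_toSet.infinite_compl
  haveI : Infinite ↥((↑S : Set (𝔼 n))ᶜ) := hinf.to_subtype
  obtain ⟨m, ⟨e⟩⟩ := Finite.exists_equiv_fin α
  let emb : α → ↥((↑S : Set (𝔼 n))ᶜ) := fun a => Infinite.natEmbedding _ (e a)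
  refine ⟨fun a => (emb a : 𝔼 n), fun a b h => ?_, fun a => (emb a).2⟩
  have h1 : emb a = emb b := Subtype.ext h
  have h2 : (e a : ℕ) = e b := (Infinite.natEmbedding _).injective h1
  exact e.injective (Fin.ext h2)

end Fresh

/-! ### Index sets and cardinalities -/

section IdxCard

variable {N : ℕ} {V : Type*} [DecidableEq V] {vtx : Fin N → V}

/-- With an injective enumeration covering `s`, the index set of `s` has the cardinality of `s`.
[folklore] -/
theorem card_idx_eq (hinj : Injective vtx) {s : Finset V} (hs : ∀ v ∈ s, ∃ i, vtx i = v) :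
    (idx vtx s).card = s.card := by
  conv_rhs => rw [← image_vtx_idx (vtx := vtx) hs]
  rw [Finset.card_image_of_injective _ hinj]

/-- Coordinate simplices have the cardinality of their index set. [folklore] -/
theorem card_coordSimplex (J : Finset (Fin N)) : (coordSimplex J).card = J.card := by
  rw [coordSimplex, Finset.card_image_of_injective _ single_one_injective]

end IdxCard

/-! ### The coordinates of the two sheets -/

section Coords

variable {n : ℕ} {M : Type*} [TopologicalSpace M]
  {ψ e₁ e₂ : OpenPartialHomeomorph M (𝔼 n)} {F G : M ≃ₜ M} {W : Set M} {R : Set (𝔼 n)}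
  {Zc : Set M}

/-- **Compatible vertex enumerations of the two sheets.** Injective enumerations `vtxK`, `vtxL`
of finite sets containing the vertices of `K`, resp. `L`, by one `Fin N`, such that a shared
simplex `t ∈ Sh` of `L` and its image `λ(t)` in `K` have the same index set, on which
`vtxK = λ ∘ vtxL`. (Bookkeeping structure, not a named fact.) [cite: Munkres1966, 10.1] -/
structure SheetCoords (T : TwoSheets ψ e₁ e₂ F G W R Zc) where
  /-- the dimension of the coordinate space -/
  N : ℕ
  /-- the enumeration for the first sheet -/
  vtxK : Fin N → 𝔼 n
  /-- the enumeration for the second sheet -/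
  vtxL : Fin N → 𝔼 n
  hinjK : Injective vtxK
  hinjL : Injective vtxL
  hrangeK : ∀ s ∈ T.K.faces, ∀ v ∈ s, ∃ i, vtxK i = v
  hrangeL : ∀ t ∈ T.L.faces, ∀ v ∈ t, ∃ i, vtxL i = v
  hshared : ∀ t ∈ T.Sh, idx vtxL t = idx vtxK (t.image (e₁ ∘ F.symm ∘ G ∘ e₂.symm))
  hvtx : ∀ t ∈ T.Sh, ∀ i ∈ idx vtxL t, vtxK i = (e₁ ∘ F.symm ∘ G ∘ e₂.symm) (vtxL i)

/-- **Compatible vertex enumerations exist** (in dimension `n ≥ 1`): index the vertices of `K`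
and the non-shared vertices of `L`, give a shared vertex `v` of `L` the index of `λ v`, and fill
the unused values of each enumeration with fresh points. [cite: Munkres1966, 10.1] -/
theorem exists_sheetCoords (hn : 0 < n) (T : TwoSheets ψ e₁ e₂ F G W R Zc) :
    Nonempty (SheetCoords T) := by
  classical
  set lam : 𝔼 n → 𝔼 n := e₁ ∘ F.symm ∘ G ∘ e₂.symm with hlam
  -- vertex sets
  set VK : Finset (𝔼 n) := T.hKfin.toFinset.biUnion id with hVK
  set VL : Finset (𝔼 n) := T.hLfin.toFinset.biUnion id with hVL
  have hmemVK : ∀ v, v ∈ VK ↔ ∃ s ∈ T.K.faces, v ∈ s := fun v => by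
    simp only [hVK, Finset.mem_biUnion, Set.Finite.mem_toFinset, id]
  have hmemVL : ∀ v, v ∈ VL ↔ ∃ t ∈ T.L.faces, v ∈ t := fun v => by
    simp only [hVL, Finset.mem_biUnion, Set.Finite.mem_toFinset, id]
  -- shared vertices of `L`: `{v} ∈ Sh`
  have hshv : ∀ t ∈ T.Sh, ∀ v ∈ t, ({v} : Finset (𝔼 n)) ∈ T.Sh := fun t ht v hv =>
    T.hShdown t ht {v} (Finset.singleton_subset_iff.2 hv) (Finset.singleton_nonempty v)
  have hlamVK : ∀ v, ({v} : Finset (𝔼 n)) ∈ T.Sh → lam v ∈ VK := fun v hv => by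
    refine (hmemVK _).2 ⟨({v} : Finset (𝔼 n)).image lam, T.hShimg _ hv, ?_⟩
    simp
  set Vsh : Set (𝔼 n) := {v | ({v} : Finset (𝔼 n)) ∈ T.Sh} with hVsh
  have hlaminj : InjOn lam Vsh := by
    intro v hv v' hv' h
    have hvV := T.hShV {v} hv (subset_convexHull ℝ (({v} : Finset (𝔼 n)) : Set (𝔼 n))
      (Finset.mem_coe.2 (Finset.mem_singleton_self v)))
    have hv'V := T.hShV {v'} hv' (subset_convexHull ℝ (({v'} : Finset (𝔼 n)) : Set (𝔼 n))
      (Finset.mem_coe.2 (Finset.mem_singleton_self v')))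
    exact injOn_comparison e₁ e₂ F G W hvV hv'V h
  -- the non-shared vertices of `L`
  set VLo : Finset (𝔼 n) := VL.filter fun v => ({v} : Finset (𝔼 n)) ∉ T.Sh with hVLo
  -- the index type
  set N : ℕ := VK.card + VLo.card with hN
  let σ : Fin N ≃ (↥VK ⊕ ↥VLo) :=
    finSumFinEquiv.symm.trans (Equiv.sumCongr VK.equivFin.symm VLo.equivFin.symm)
  -- fresh points
  obtain ⟨freshK, hfreshKinj, hfreshK⟩ := exists_injective_forall_notMem hn VK ↥VLo
  obtain ⟨freshL, hfreshLinj, hfreshL⟩ := exists_injective_forall_notMem hn VL ↥VK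
  -- the enumerations
  let vtxK : Fin N → 𝔼 n := fun i => Sum.elim (fun v : ↥VK => (v : 𝔼 n)) freshK (σ i)
  let vtxL : Fin N → 𝔼 n := fun i => Sum.elim
    (fun v : ↥VK => if (v : 𝔼 n) ∈ lam '' Vsh then invFunOn lam Vsh (v : 𝔼 n) else freshL v)
    (fun w : ↥VLo => (w : 𝔼 n)) (σ i)
  have hvtxK : ∀ i, vtxK i = Sum.elim (fun v : ↥VK => (v : 𝔼 n)) freshK (σ i) := fun i => rfl
  have hvtxL : ∀ i, vtxL i = Sum.elim
      (fun v : ↥VK => if (v : 𝔼 n) ∈ lam '' Vsh then invFunOn lam Vsh (v : 𝔼 n) else freshL v)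
      (fun w : ↥VLo => (w : 𝔼 n)) (σ i) := fun i => rfl
  -- values of `vtxL` on the first block
  have hinv : ∀ v ∈ lam '' Vsh, invFunOn lam Vsh v ∈ Vsh ∧ lam (invFunOn lam Vsh v) = v :=
    fun v hv => ⟨invFunOn_mem hv, invFunOn_eq hv⟩
  have hinvlam : ∀ w ∈ Vsh, invFunOn lam Vsh (lam w) = w := fun w hw =>
    hlaminj.leftInvOn_invFunOn hw
  have hVshVL : ∀ w ∈ Vsh, w ∈ VL := fun w hw =>
    (hmemVL w).2 ⟨{w}, T.hSh hw, Finset.mem_singleton_self w⟩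
  have hVLo : ∀ w : ↥VLo, (w : 𝔼 n) ∈ VL ∧ (w : 𝔼 n) ∉ Vsh := fun w =>
    Finset.mem_filter.1 w.2
  have hShVL : ∀ t ∈ T.Sh, ∀ v ∈ t, v ∈ VL := fun t ht v hv => (hmemVL v).2 ⟨t, T.hSh ht, hv⟩
  have hShVsh : ∀ t ∈ T.Sh, ∀ v ∈ t, v ∈ Vsh := fun t ht v hv => hshv t ht v hv
  have himgVK : ∀ t ∈ T.Sh, ∀ v ∈ t.image lam, v ∈ VK := fun t ht v hv =>
    (hmemVK v).2 ⟨t.image lam, T.hShimg t ht, hv⟩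
  -- injectivity
  have hinjK : Injective vtxK := by
    intro i j h
    simp only [hvtxK] at h
    apply σ.injective
    rcases hi : σ i with v | w <;> rcases hj : σ j with v' | w' <;>
      simp only [hi, hj, Sum.elim_inl, Sum.elim_inr] at h
    · rw [Subtype.ext h]
    · exact (hfreshK w' (by rw [← h]; exact v.2)).elim
    · exact (hfreshK w (by rw [h]; exact v'.2)).elim
    · rw [hfreshKinj h]
  have hinjL : Injective vtxL := by
    intro i j h
    simp only [hvtxL] at h
    apply σ.injective
    rcases hi : σ i with v | w <;> rcases hj : σ j with v' | w' <;>
      simp only [hi, hj, Sum.elim_inl, Sum.elim_inr] at h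
    · by_cases hv : (v : 𝔼 n) ∈ lam '' Vsh <;> by_cases hv' : (v' : 𝔼 n) ∈ lam '' Vsh <;>
        simp only [hv, hv', if_true, if_false] at h
      · have : (v : 𝔼 n) = v' := by rw [← (hinv _ hv).2, ← (hinv _ hv').2, h]
        rw [Subtype.ext this]
      · exact (hfreshL v' (by rw [← h]; exact hVshVL _ (hinv _ hv).1)).elim
      · exact (hfreshL v (by rw [h]; exact hVshVL _ (hinv _ hv').1)).elim
      · rw [hfreshLinj h]
    · by_cases hv : (v : 𝔼 n) ∈ lam '' Vsh <;> simp only [hv, if_true, if_false] at h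
      · exact ((hVLo w').2 (by rw [← h]; exact (hinv _ hv).1)).elim
      · exact (hfreshL v (by rw [h]; exact (hVLo w').1)).elim
    · by_cases hv' : (v' : 𝔼 n) ∈ lam '' Vsh <;> simp only [hv', if_true, if_false] at h
      · exact ((hVLo w).2 (by rw [h]; exact (hinv _ hv').1)).elim
      · exact (hfreshL v' (by rw [← h]; exact (hVLo w).1)).elim
    · rw [Subtype.ext h]
  -- ranges
  have hrangeK : ∀ s ∈ T.K.faces, ∀ v ∈ s, ∃ i, vtxK i = v := fun s hs v hv => by
    refine ⟨σ.symm (Sum.inl ⟨v, (hmemVK v).2 ⟨s, hs, hv⟩⟩), ?_⟩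
    rw [hvtxK, Equiv.apply_symm_apply, Sum.elim_inl]
  have hrangeL : ∀ t ∈ T.L.faces, ∀ v ∈ t, ∃ i, vtxL i = v := fun t ht v hv => by
    by_cases hsh : ({v} : Finset (𝔼 n)) ∈ T.Sh
    · refine ⟨σ.symm (Sum.inl ⟨lam v, hlamVK v hsh⟩), ?_⟩
      have hmem : lam v ∈ lam '' Vsh := ⟨v, hsh, rfl⟩
      rw [hvtxL, Equiv.apply_symm_apply, Sum.elim_inl]
      simp only [hmem, if_true]
      exact hinvlam v hsh
    · have hvo : v ∈ VLo := Finset.mem_filter.2 ⟨(hmemVL v).2 ⟨t, ht, hv⟩, hsh⟩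
      refine ⟨σ.symm (Sum.inr ⟨v, hvo⟩), ?_⟩
      rw [hvtxL, Equiv.apply_symm_apply, Sum.elim_inr]
  -- compatibility on shared simplices
  have hkey : ∀ t ∈ T.Sh, ∀ i, (vtxL i ∈ t ↔ vtxK i ∈ t.image lam) ∧
      (vtxL i ∈ t → vtxK i = lam (vtxL i)) := by
    intro t ht i
    simp only [hvtxK, hvtxL]
    rcases hi : σ i with v | w <;> simp only [Sum.elim_inl, Sum.elim_inr]
    · by_cases hv : (v : 𝔼 n) ∈ lam '' Vsh <;> simp only [hv, if_true, if_false]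
      · obtain ⟨hw, hlw⟩ := hinv _ hv
        refine ⟨⟨fun h => Finset.mem_image.2 ⟨_, h, hlw⟩, fun h => ?_⟩, fun _ => hlw.symm⟩
        obtain ⟨u, hu, huv⟩ := Finset.mem_image.1 h
        have : invFunOn lam Vsh (v : 𝔼 n) = u :=
          hlaminj hw (hShVsh t ht u hu) (by rw [hlw, huv])
        rw [this]; exact hu
      · refine ⟨⟨fun h => (hfreshL v (hShVL t ht _ h)).elim, fun h => ?_⟩,
          fun h => (hfreshL v (hShVL t ht _ h)).elim⟩
        obtain ⟨u, hu, huv⟩ := Finset.mem_image.1 h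
        exact (hv ⟨u, hShVsh t ht u hu, huv⟩).elim
    · refine ⟨⟨fun h => ((hVLo w).2 (hShVsh t ht _ h)).elim, fun h => ?_⟩,
        fun h => ((hVLo w).2 (hShVsh t ht _ h)).elim⟩
      exact (hfreshK w (himgVK t ht _ h)).elim
  refine ⟨{
    N := N
    vtxK := vtxK
    vtxL := vtxL
    hinjK := hinjK
    hinjL := hinjL
    hrangeK := hrangeK
    hrangeL := hrangeL
    hshared := fun t ht => ?_
    hvtx := fun t ht i hi => ((hkey t ht i).2 (mem_idx_iff.1 hi)) }⟩
  ext i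
  rw [mem_idx_iff, mem_idx_iff]
  exact (hkey t ht i).1

namespace SheetCoords

variable {T : TwoSheets ψ e₁ e₂ F G W R Zc} (C : SheetCoords T)

/-- The coordinate complex of the first sheet. [folklore] -/
def PK : Geometry.SimplicialComplex ℝ (Fin C.N → ℝ) := canonical T.K C.vtxK C.hinjK C.hrangeK

/-- The coordinate complex of the second sheet. [folklore] -/
def PL : Geometry.SimplicialComplex ℝ (Fin C.N → ℝ) := canonical T.L C.vtxL C.hinjL C.hrangeL

/-- Faces of `PK`. [folklore] -/
theorem mem_PK_faces {τ : Finset (Fin C.N → ℝ)} :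
    τ ∈ C.PK.faces ↔ ∃ s ∈ T.K.faces, coordSimplex (idx C.vtxK s) = τ := Iff.rfl

/-- Faces of `PL`. [folklore] -/
theorem mem_PL_faces {τ : Finset (Fin C.N → ℝ)} :
    τ ∈ C.PL.faces ↔ ∃ t ∈ T.L.faces, coordSimplex (idx C.vtxL t) = τ := Iff.rfl

/-- `PK` is a coordinate complex. [folklore] -/
theorem isCoordinate_PK : IsCoordinate C.PK := isCoordinate_canonical

/-- `PL` is a coordinate complex. [folklore] -/
theorem isCoordinate_PL : IsCoordinate C.PL := isCoordinate_canonical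

/-- `PK` is finite. [folklore] -/
theorem PK_finite : C.PK.faces.Finite := canonical_faces_finite T.hKfin

/-- `PL` is finite. [folklore] -/
theorem PL_finite : C.PL.faces.Finite := canonical_faces_finite T.hLfin

/-- `PK` is pure of dimension `n`. [folklore] -/
theorem PK_pure : ∀ r ∈ C.PK.faces, ∃ s ∈ C.PK.faces, r ⊆ s ∧ s.card = n + 1 := by
  classical
  rintro _ ⟨r, hr, rfl⟩
  obtain ⟨s, hs, hrs, hcard⟩ := T.hKpure r hr
  refine ⟨coordSimplex (idx C.vtxK s), ⟨s, hs, rfl⟩, coordSimplex_subset_iff.2 (idx_mono hrs), ?_⟩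
  rw [card_coordSimplex, card_idx_eq C.hinjK (C.hrangeK s hs), hcard]

/-- `PL` is pure of dimension `n`. [folklore] -/
theorem PL_pure : ∀ r ∈ C.PL.faces, ∃ s ∈ C.PL.faces, r ⊆ s ∧ s.card = n + 1 := by
  classical
  rintro _ ⟨r, hr, rfl⟩
  obtain ⟨s, hs, hrs, hcard⟩ := T.hLpure r hr
  refine ⟨coordSimplex (idx C.vtxL s), ⟨s, hs, rfl⟩, coordSimplex_subset_iff.2 (idx_mono hrs), ?_⟩
  rw [card_coordSimplex, card_idx_eq C.hinjL (C.hrangeL s hs), hcard]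

/-- The sheet map of the first sheet: `F ∘ e₁.symm ∘ realK`. [folklore] -/
def fK : (Fin C.N → ℝ) → M := fun x => F (e₁.symm (real C.vtxK x))

/-- The sheet map of the second sheet: `G ∘ e₂.symm ∘ realL`. [folklore] -/
def fL : (Fin C.N → ℝ) → M := fun x => G (e₂.symm (real C.vtxL x))

/-- Auxiliary (`fK_apply`). [folklore] -/
theorem fK_apply (x : Fin C.N → ℝ) : C.fK x = F (e₁.symm (real C.vtxK x)) := rfl

/-- Auxiliary (`fL_apply`). [folklore] -/
theorem fL_apply (x : Fin C.N → ℝ) : C.fL x = G (e₂.symm (real C.vtxL x)) := rfl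

/-- Realisation of `PK.space`. [folklore] -/
theorem realK_space : real C.vtxK '' C.PK.space = T.K.space := image_real_canonical_space

/-- Realisation of `PL.space`. [folklore] -/
theorem realL_space : real C.vtxL '' C.PL.space = T.L.space := image_real_canonical_space

/-- Auxiliary (`realK_mem`). [folklore] -/
theorem realK_mem {x : Fin C.N → ℝ} (hx : x ∈ C.PK.space) : real C.vtxK x ∈ T.K.space := by
  rw [← C.realK_space]; exact ⟨x, hx, rfl⟩

/-- Auxiliary (`realL_mem`). [folklore] -/
theorem realL_mem {x : Fin C.N → ℝ} (hx : x ∈ C.PL.space) : real C.vtxL x ∈ T.L.space := by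
  rw [← C.realL_space]; exact ⟨x, hx, rfl⟩

/-- Realisation of a closed coordinate simplex of `PK`. [folklore] -/
theorem realK_convexHull {s : Finset (𝔼 n)} (hs : s ∈ T.K.faces) :
    real C.vtxK '' convexHull ℝ ((coordSimplex (idx C.vtxK s) : Finset (Fin C.N → ℝ)) :
      Set (Fin C.N → ℝ)) = convexHull ℝ (s : Set (𝔼 n)) := by
  classical
  exact image_real_convexHull (C.hrangeK s hs)

/-- Realisation of a closed coordinate simplex of `PL`. [folklore] -/
theorem realL_convexHull {t : Finset (𝔼 n)} (ht : t ∈ T.L.faces) :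
    real C.vtxL '' convexHull ℝ ((coordSimplex (idx C.vtxL t) : Finset (Fin C.N → ℝ)) :
      Set (Fin C.N → ℝ)) = convexHull ℝ (t : Set (𝔼 n)) := by
  classical
  exact image_real_convexHull (C.hrangeL t ht)

/-- `realK` is injective on `PK.space`. [folklore] -/
theorem injOn_realK : InjOn (real C.vtxK) C.PK.space := by
  classical
  exact injOn_real_canonical_space

/-- `realL` is injective on `PL.space`. [folklore] -/
theorem injOn_realL : InjOn (real C.vtxL) C.PL.space := by
  classical
  exact injOn_real_canonical_space

/-- The first sheet map is injective on `PK.space`. [folklore] -/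
theorem injOn_fK : InjOn C.fK C.PK.space := by
  intro x hx y hy h
  have h1 : e₁.symm (real C.vtxK x) = e₁.symm (real C.vtxK y) := F.injective h
  have h2 := e₁.symm.injOn (by rw [e₁.symm_source]; exact (T.hKU (C.realK_mem hx)).1)
    (by rw [e₁.symm_source]; exact (T.hKU (C.realK_mem hy)).1) h1
  exact C.injOn_realK hx hy h2

/-- The second sheet map is injective on `PL.space`. [folklore] -/
theorem injOn_fL : InjOn C.fL C.PL.space := by
  intro x hx y hy h
  have h1 : e₂.symm (real C.vtxL x) = e₂.symm (real C.vtxL y) := G.injective h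
  have h2 := e₂.symm.injOn (by rw [e₂.symm_source]; exact (T.hLU (C.realL_mem hx)).1)
    (by rw [e₂.symm_source]; exact (T.hLU (C.realL_mem hy)).1) h1
  exact C.injOn_realL hx hy h2

/-- The first sheet map is continuous on closed simplices. [folklore] -/
theorem continuousOn_fK {τ : Finset (Fin C.N → ℝ)} (hτ : τ ∈ C.PK.faces) :
    ContinuousOn C.fK (convexHull ℝ (τ : Set (Fin C.N → ℝ))) := by
  refine F.continuous.comp_continuousOn (e₁.continuousOn_symm.comp
    (real C.vtxK).continuous_of_finiteDimensional.continuousOn fun x hx => ?_)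
  exact (T.hKU (C.realK_mem (C.PK.convexHull_subset_space hτ hx))).1

/-- The second sheet map is continuous on closed simplices. [folklore] -/
theorem continuousOn_fL {τ : Finset (Fin C.N → ℝ)} (hτ : τ ∈ C.PL.faces) :
    ContinuousOn C.fL (convexHull ℝ (τ : Set (Fin C.N → ℝ))) := by
  refine G.continuous.comp_continuousOn (e₂.continuousOn_symm.comp
    (real C.vtxL).continuous_of_finiteDimensional.continuousOn fun x hx => ?_)
  exact (T.hLU (C.realL_mem (C.PL.convexHull_subset_space hτ hx))).1

/-- The whole of `PK.space` is mapped into `ψ.source` by the first sheet map. [folklore] -/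
theorem fK_mem_source {x : Fin C.N → ℝ} (hx : x ∈ C.PK.space) : C.fK x ∈ ψ.source :=
  (T.hKU (C.realK_mem hx)).2

/-- The whole of `PL.space` is mapped into `ψ.source` by the second sheet map. [folklore] -/
theorem fL_mem_source {x : Fin C.N → ℝ} (hx : x ∈ C.PL.space) : C.fL x ∈ ψ.source :=
  (T.hLU (C.realL_mem hx)).2

/-! #### Shared coordinate simplices -/

/-- The shared coordinate simplices: the coordinate simplices of the members of `Sh`. [folklore] -/
def ShC : Set (Finset (Fin C.N → ℝ)) := {τ | ∃ t ∈ T.Sh, coordSimplex (idx C.vtxL t) = τ}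

/-- Shared coordinate simplices are faces of `PL`. [folklore] -/
theorem mem_PL_of_shC {τ : Finset (Fin C.N → ℝ)} (h : τ ∈ C.ShC) : τ ∈ C.PL.faces := by
  obtain ⟨t, ht, rfl⟩ := h
  exact ⟨t, T.hSh ht, rfl⟩

/-- Shared coordinate simplices are faces of `PK`. [folklore] -/
theorem mem_PK_of_shC {τ : Finset (Fin C.N → ℝ)} (h : τ ∈ C.ShC) : τ ∈ C.PK.faces := by
  obtain ⟨t, ht, rfl⟩ := h
  exact ⟨t.image (e₁ ∘ F.symm ∘ G ∘ e₂.symm), T.hShimg t ht, by rw [← C.hshared t ht]⟩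

/-- `ShC` is down-closed. [folklore] -/
theorem shC_down {τ : Finset (Fin C.N → ℝ)} (h : τ ∈ C.ShC) {τ' : Finset (Fin C.N → ℝ)}
    (hτ' : τ' ⊆ τ) (hne : τ'.Nonempty) : τ' ∈ C.ShC := by
  classical
  obtain ⟨t, ht, rfl⟩ := h
  obtain ⟨J, hJ, rfl⟩ := exists_eq_coordSimplex_of_subset hτ'
  have hJne : J.Nonempty := by
    obtain ⟨v, hv⟩ := hne
    obtain ⟨i, hi, rfl⟩ := mem_coordSimplex_iff.1 hv
    exact ⟨i, hi⟩
  refine ⟨J.image C.vtxL, T.hShdown t ht _ (fun v hv => ?_) (hJne.image _), ?_⟩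
  · obtain ⟨i, hi, rfl⟩ := Finset.mem_image.1 hv
    exact mem_idx_iff.1 (hJ hi)
  · rw [idx_image_vtx C.hinjL]

/-- **On a shared coordinate simplex, `realK = λ ∘ realL`.** [cite: Munkres1966, 10.1] -/
theorem realK_eq_of_mem_Sh {t : Finset (𝔼 n)} (ht : t ∈ T.Sh) {x : Fin C.N → ℝ}
    (hx : x ∈ convexHull ℝ ((coordSimplex (idx C.vtxL t) : Finset (Fin C.N → ℝ)) :
      Set (Fin C.N → ℝ))) :
    real C.vtxK x = (e₁ ∘ F.symm ∘ G ∘ e₂.symm) (real C.vtxL x) := by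
  classical
  obtain ⟨A, hA⟩ := (T.hShaff t ht).out
  have hreal : real C.vtxL x ∈ convexHull ℝ (t : Set (𝔼 n)) := by
    rw [← C.realL_convexHull (T.hSh ht)]; exact ⟨x, hx, rfl⟩
  rw [hA hreal]
  -- two affine maps agreeing on the vertices of the coordinate simplex
  have key := affine_eqOn_convexHull_of_forall_eq (t := coordSimplex (idx C.vtxL t))
    (A := (real C.vtxK).toAffineMap) (B := A.comp (real C.vtxL).toAffineMap) fun v hv => by
      obtain ⟨i, hi, rfl⟩ := mem_coordSimplex_iff.1 hv
      have hit : C.vtxL i ∈ t := mem_idx_iff.1 hi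
      rw [LinearMap.coe_toAffineMap, AffineMap.comp_apply, LinearMap.coe_toAffineMap, real_single,
        real_single, ← hA (subset_convexHull ℝ _ hit), C.hvtx t ht i hi]
  exact key hx

/-- **The two sheet maps agree on shared coordinate simplices.** [cite: Munkres1966, 10.1] -/
theorem fK_eq_fL {τ : Finset (Fin C.N → ℝ)} (hτ : τ ∈ C.ShC) {x : Fin C.N → ℝ}
    (hx : x ∈ convexHull ℝ (τ : Set (Fin C.N → ℝ))) : C.fK x = C.fL x := by
  obtain ⟨t, ht, rfl⟩ := hτ
  have hreal : real C.vtxL x ∈ convexHull ℝ (t : Set (𝔼 n)) := by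
    rw [← C.realL_convexHull (T.hSh ht)]; exact ⟨x, hx, rfl⟩
  have hV := T.hShV t ht hreal
  rw [fK_apply, fL_apply, C.realK_eq_of_mem_Sh ht hx]
  have hsrc : F.symm (G (e₂.symm (real C.vtxL x))) ∈ e₁.source := hV.2.2
  show F (e₁.symm (e₁ (F.symm (G (e₂.symm (real C.vtxL x)))))) = G (e₂.symm (real C.vtxL x))
  rw [e₁.left_inv hsrc, Homeomorph.apply_symm_apply]

/-- **A simplex of `PL` whose image meets `Zc` is shared.** [cite: Munkres1966, 10.1] -/
theorem shC_of_mem_PL {τ : Finset (Fin C.N → ℝ)} (hτ : τ ∈ C.PL.faces)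
    (h : ∃ x ∈ convexHull ℝ (τ : Set (Fin C.N → ℝ)), C.fL x ∈ Zc) : τ ∈ C.ShC := by
  obtain ⟨t, ht, rfl⟩ := hτ
  obtain ⟨x, hx, hxZ⟩ := h
  have hreal : real C.vtxL x ∈ convexHull ℝ (t : Set (𝔼 n)) := by
    rw [← C.realL_convexHull ht]; exact ⟨x, hx, rfl⟩
  exact ⟨t, T.hLshare t ht ⟨real C.vtxL x, hreal, hxZ⟩, rfl⟩

/-- **A simplex of `PK` whose image meets `Zc` is shared.** [cite: Munkres1966, 10.1] -/
theorem shC_of_mem_PK {τ : Finset (Fin C.N → ℝ)} (hτ : τ ∈ C.PK.faces)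
    (h : ∃ x ∈ convexHull ℝ (τ : Set (Fin C.N → ℝ)), C.fK x ∈ Zc) : τ ∈ C.ShC := by
  obtain ⟨s, hs, rfl⟩ := hτ
  obtain ⟨x, hx, hxZ⟩ := h
  have hreal : real C.vtxK x ∈ convexHull ℝ (s : Set (𝔼 n)) := by
    rw [← C.realK_convexHull hs]; exact ⟨x, hx, rfl⟩
  obtain ⟨t, ht, hts⟩ := T.hKshare s hs ⟨real C.vtxK x, hreal, hxZ⟩
  refine ⟨t, ht, ?_⟩
  rw [C.hshared t ht, hts]

/-! #### Smooth chart models of the sheet maps -/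

/-- The realisation is injective on the direction space of a face of `PK`. [folklore] -/
theorem realK_eq_zero {τ : Finset (Fin C.N → ℝ)} (hτ : τ ∈ C.PK.faces) {u : Fin C.N → ℝ}
    (hu : u ∈ vectorSpan ℝ (τ : Set (Fin C.N → ℝ))) (h0 : real C.vtxK u = 0) : u = 0 :=
  linear_eq_zero_of_injOn_convexHull (real C.vtxK).toAffineMap
    (C.injOn_realK.mono (C.PK.convexHull_subset_space hτ)) hu h0

/-- The realisation is injective on the direction space of a face of `PL`. [folklore] -/
theorem realL_eq_zero {τ : Finset (Fin C.N → ℝ)} (hτ : τ ∈ C.PL.faces) {u : Fin C.N → ℝ}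
    (hu : u ∈ vectorSpan ℝ (τ : Set (Fin C.N → ℝ))) (h0 : real C.vtxL u = 0) : u = 0 :=
  linear_eq_zero_of_injOn_convexHull (real C.vtxL).toAffineMap
    (C.injOn_realL.mono (C.PL.convexHull_subset_space hτ)) hu h0

/-- **Smooth chart models of the first sheet map** for the chart `ψ`, on every face of `PK`
(in the form required by `BendInput.model`). [cite: Munkres1966, 8.3] -/
theorem model_fK {τ : Finset (Fin C.N → ℝ)} (hτ : τ ∈ C.PK.faces) :
    ∃ O : Set (Fin C.N → ℝ), ∃ Gm : (Fin C.N → ℝ) → 𝔼 n, IsOpen O ∧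
      convexHull ℝ (τ : Set (Fin C.N → ℝ)) ∩ C.fK ⁻¹' ψ.source ⊆ O ∧ ContDiffOn ℝ ∞ Gm O ∧
      EqOn (ψ ∘ C.fK) Gm (convexHull ℝ (τ : Set (Fin C.N → ℝ)) ∩ C.fK ⁻¹' ψ.source) ∧
      ∀ x ∈ convexHull ℝ (τ : Set (Fin C.N → ℝ)) ∩ C.fK ⁻¹' ψ.source,
        ∀ u ∈ vectorSpan ℝ (τ : Set (Fin C.N → ℝ)), fderiv ℝ Gm x u = 0 → u = 0 := by
  obtain ⟨s, hs, rfl⟩ := id hτ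
  obtain ⟨g, hg, hφg, hginj⟩ := (T.hKmodel s hs).out
  refine ⟨univ, g ∘ real C.vtxK, isOpen_univ, subset_univ _, ?_, fun x hx => ?_, fun x hx u hu h0 => ?_⟩
  · exact (hg.comp (real C.vtxK).toContinuousLinearMap.contDiff).contDiffOn
  · have hreal : real C.vtxK x ∈ convexHull ℝ (s : Set (𝔼 n)) := by
      rw [← C.realK_convexHull hs]; exact ⟨x, hx.1, rfl⟩
    show ψ (F (e₁.symm (real C.vtxK x))) = g (real C.vtxK x)
    exact hφg hreal
  · have hreal : real C.vtxK x ∈ convexHull ℝ (s : Set (𝔼 n)) := by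
      rw [← C.realK_convexHull hs]; exact ⟨x, hx.1, rfl⟩
    have hd : HasFDerivAt (g ∘ real C.vtxK)
        ((fderiv ℝ g (real C.vtxK x)).comp (real C.vtxK).toContinuousLinearMap) x :=
      ((hg.differentiable (by simp)).differentiableAt.hasFDerivAt).comp x
        (real C.vtxK).toContinuousLinearMap.hasFDerivAt
    rw [hd.fderiv, ContinuousLinearMap.comp_apply, LinearMap.coe_toContinuousLinearMap'] at h0
    exact C.realK_eq_zero hτ hu ((hginj _ hreal).eq_iff' (map_zero _) |>.1 h0)

/-- **Smooth chart models of the second sheet map** for the chart `ψ`. [cite: Munkres1966, 8.3] -/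
theorem model_fL {τ : Finset (Fin C.N → ℝ)} (hτ : τ ∈ C.PL.faces) :
    ∃ O : Set (Fin C.N → ℝ), ∃ Gm : (Fin C.N → ℝ) → 𝔼 n, IsOpen O ∧
      convexHull ℝ (τ : Set (Fin C.N → ℝ)) ∩ C.fL ⁻¹' ψ.source ⊆ O ∧ ContDiffOn ℝ ∞ Gm O ∧
      EqOn (ψ ∘ C.fL) Gm (convexHull ℝ (τ : Set (Fin C.N → ℝ)) ∩ C.fL ⁻¹' ψ.source) ∧
      ∀ x ∈ convexHull ℝ (τ : Set (Fin C.N → ℝ)) ∩ C.fL ⁻¹' ψ.source,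
        ∀ u ∈ vectorSpan ℝ (τ : Set (Fin C.N → ℝ)), fderiv ℝ Gm x u = 0 → u = 0 := by
  obtain ⟨t, ht, rfl⟩ := id hτ
  obtain ⟨g, hg, hφg, hginj⟩ := (T.hLmodel t ht).out
  refine ⟨univ, g ∘ real C.vtxL, isOpen_univ, subset_univ _, ?_, fun x hx => ?_, fun x hx u hu h0 => ?_⟩
  · exact (hg.comp (real C.vtxL).toContinuousLinearMap.contDiff).contDiffOn
  · have hreal : real C.vtxL x ∈ convexHull ℝ (t : Set (𝔼 n)) := by
      rw [← C.realL_convexHull ht]; exact ⟨x, hx.1, rfl⟩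
    show ψ (G (e₂.symm (real C.vtxL x))) = g (real C.vtxL x)
    exact hφg hreal
  · have hreal : real C.vtxL x ∈ convexHull ℝ (t : Set (𝔼 n)) := by
      rw [← C.realL_convexHull ht]; exact ⟨x, hx.1, rfl⟩
    have hd : HasFDerivAt (g ∘ real C.vtxL)
        ((fderiv ℝ g (real C.vtxL x)).comp (real C.vtxL).toContinuousLinearMap) x :=
      ((hg.differentiable (by simp)).differentiableAt.hasFDerivAt).comp x
        (real C.vtxL).toContinuousLinearMap.hasFDerivAt
    rw [hd.fderiv, ContinuousLinearMap.comp_apply, LinearMap.coe_toContinuousLinearMap'] at h0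
    exact C.realL_eq_zero hτ hu ((hginj _ hreal).eq_iff' (map_zero _) |>.1 h0)

end SheetCoords

end Coords

end Literature.Topology.FourManifolds
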